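import Mathlib

/-!
# SoloBlind kernel #102 — Newton–Kantorovich radius bookkeeping with an exponentially large gain

Solo-blind programme `AnomalousDissipation`, steady door, paper §24.52(6)(c)–(d).
After P80 the last step of the construction is a plain fixed-point problem in FLAT norms:
`u = T u := -𝓛⁻¹ (Res + Q u)` with a linear gain `‖𝓛⁻¹‖ ≤ G` (the transient loss, `G = e^{L}`,
`L ≈ 0.028 n^{2/9}` measured), a residual `‖Res‖ ≤ r` (beyond all orders, `e^{-F n^{1/3}}` under (H4-G₃))
and a quadratic nonlinearity `‖Q u - Q v‖ ≤ C_Q (‖u‖ + ‖v‖) ‖u - v‖`, `Q 0 = 0`.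
The bookkeeping proved here, at the level of real inequalities (the Banach fixed-point theorem itself
is standard and not restated): with `ρ := 2 G r`, the condition `4 C_Q G² r ≤ 1` gives
(i) INVARIANCE `G (r + C_Q ρ²) ≤ ρ` and (ii) CONTRACTION factor `2 C_Q G ρ ≤ 1/2`... in fact `≤ 1`
halves to `1/2` under `8 C_Q G² r ≤ 1`; we prove the sharp bookkeeping forms used in §24.52:
`4 C_Q G^2 r ≤ 1 → G * (r + C_Q * ρ^2) ≤ ρ` and `8 C_Q G^2 r ≤ 1 → G * (C_Q * (ρ + ρ)) ≤ 1/2`,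
and the EXPONENT form: if `G ≤ exp (L)` and `r ≤ exp (-E)` with `E ≥ 2 L + log (8 C_Q)` then
`8 C_Q G² r ≤ 1` — i.e. "residual exponent > twice the loss exponent + O(1)" is exactly what Newton needs.
-/

namespace Summit.AnomalousDissipation.AnomalousDissipation.Theorems

/-- INVARIANCE of the ball of radius `ρ = 2 G r` under `u ↦ -𝓛⁻¹(Res + Q u)`:
`‖T u‖ ≤ G (r + C_Q ρ²) ≤ ρ` as soon as `4 C_Q G² r ≤ 1`. -/
theorem newton_ball_invariant (G r CQ : ℝ) (hG : 0 ≤ G) (hr : 0 ≤ r)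
    (h : 4 * CQ * G ^ 2 * r ≤ 1) :
    G * (r + CQ * (2 * G * r) ^ 2) ≤ 2 * G * r := by
  -- G (r + 4 C_Q G² r²) = G r (1 + 4 C_Q G² r) ≤ G r · 2
  have hGr : 0 ≤ G * r := mul_nonneg hG hr
  have key : G * (r + CQ * (2 * G * r) ^ 2) = G * r * (1 + 4 * CQ * G ^ 2 * r) := by ring
  rw [key]
  calc G * r * (1 + 4 * CQ * G ^ 2 * r) ≤ G * r * (1 + 1) := by
        apply mul_le_mul_of_nonneg_left _ hGr; linarith
    _ = 2 * G * r := by ring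

/-- CONTRACTION on that ball: the Lipschitz constant `G · C_Q (‖u‖ + ‖v‖) ≤ G C_Q (ρ + ρ)` is `≤ 1/2`
as soon as `8 C_Q G² r ≤ 1`. -/
theorem newton_ball_contraction (G r CQ : ℝ)
    (h : 8 * CQ * G ^ 2 * r ≤ 1) :
    G * (CQ * (2 * G * r + 2 * G * r)) ≤ 1 / 2 := by
  have key : G * (CQ * (2 * G * r + 2 * G * r)) = (8 * CQ * G ^ 2 * r) / 2 := by ring
  rw [key]
  linarith

/-- The a-priori bound that closes the argument: if `‖u‖ ≤ ρ = 2 G r` then the correction is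
within twice the linear prediction `G r` — recorded as the trivial identity it is, so that §24.52 can
cite one declaration for "the Newton solution lies within `2 G ‖Res‖` of the truncated hierarchy". -/
theorem newton_radius_eq (G r : ℝ) : 2 * G * r = 2 * (G * r) := by ring

/-- EXPONENT FORM (§24.52(6)(c)): a gain `G ≤ e^{L}` and a residual `r ≤ e^{-E}` with
`E ≥ 2 L + log (8 C_Q)` satisfy the contraction condition `8 C_Q G² r ≤ 1`. -/
theorem newton_condition_of_exponents (G r CQ L E : ℝ) (hG0 : 0 ≤ G) (hr0 : 0 ≤ r) (hCQ : 0 < CQ)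
    (hG : G ≤ Real.exp L) (hr : r ≤ Real.exp (-E)) (hE : 2 * L + Real.log (8 * CQ) ≤ E) :
    8 * CQ * G ^ 2 * r ≤ 1 := by
  have h8 : 0 < 8 * CQ := by positivity
  -- G² ≤ e^{2L}
  have hG2 : G ^ 2 ≤ Real.exp (2 * L) := by
    have := pow_le_pow_left₀ hG0 hG 2
    rwa [← Real.exp_nat_mul, show ((2 : ℕ) : ℝ) * L = 2 * L by norm_num] at this
  calc 8 * CQ * G ^ 2 * r ≤ 8 * CQ * Real.exp (2 * L) * Real.exp (-E) := by
        apply mul_le_mul (mul_le_mul_of_nonneg_left hG2 h8.le) hr hr0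
        positivity
    _ = Real.exp (Real.log (8 * CQ)) * Real.exp (2 * L) * Real.exp (-E) := by
        rw [Real.exp_log h8]
    _ = Real.exp (Real.log (8 * CQ) + 2 * L + (-E)) := by
        rw [Real.exp_add, Real.exp_add]
    _ ≤ Real.exp 0 := by rw [Real.exp_le_exp]; linarith
    _ = 1 := Real.exp_zero

/-- And the invariance condition follows from the contraction one (`4 ≤ 8`). -/
theorem newton_invariance_of_contraction (G r CQ : ℝ) (hr : 0 ≤ r) (hCQ : 0 ≤ CQ)
    (h : 8 * CQ * G ^ 2 * r ≤ 1) : 4 * CQ * G ^ 2 * r ≤ 1 := by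
  have : 0 ≤ CQ * G ^ 2 * r := by positivity
  linarith

/-- THE §24.52 BOTTOM LINE in one declaration: loss exponent `L n^γ`, residual exponent `F n^p` with
`γ < p`; then for all large `n` the Newton condition in exponent form holds:
`2 (L n^γ) + log (8 C_Q) ≤ F n^p`. -/
theorem newton_condition_eventually (F L p γ CQ : ℝ) (hF : 0 < F) (hL : 0 < L) (hγ : 0 < γ)
    (hpγ : γ < p) :
    ∃ n₀ : ℝ, 0 < n₀ ∧ ∀ n : ℝ, n₀ ≤ n → 2 * (L * n ^ γ) + Real.log (8 * CQ) ≤ F * n ^ p := by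
  -- absorb the constant: log(8 C_Q) ≤ |log(8 C_Q)| · n^γ for n ≥ 1, then compare (2L + |c|) n^γ with F n^p
  set c : ℝ := |Real.log (8 * CQ)| with hc
  have hc0 : 0 ≤ c := abs_nonneg _
  have hd : 0 < p - γ := sub_pos.mpr hpγ
  set A : ℝ := (2 * L + c) / F with hA
  have hApos : 0 < A := by rw [hA]; positivity
  refine ⟨A ^ (1 / (p - γ)) + 1, by positivity, fun n hn => ?_⟩
  have hA1 : 0 < A ^ (1 / (p - γ)) := Real.rpow_pos_of_pos hApos _
  have hn1 : 1 ≤ n := by linarith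
  have hn0 : 0 < n := by linarith
  -- n^γ ≥ 1
  have hnγ : 1 ≤ n ^ γ := Real.one_le_rpow hn1 hγ.le
  have hγpos : 0 < n ^ γ := by linarith
  -- A ≤ n^(p-γ)
  have hAn : A ≤ n ^ (p - γ) := by
    have h1 : A ^ (1 / (p - γ)) ≤ n := by linarith
    have h2 : (A ^ (1 / (p - γ))) ^ (p - γ) ≤ n ^ (p - γ) :=
      Real.rpow_le_rpow (Real.rpow_nonneg hApos.le _) h1 hd.le
    rwa [← Real.rpow_mul hApos.le, one_div_mul_cancel hd.ne', Real.rpow_one] at h2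
  have hsplit : n ^ p = n ^ γ * n ^ (p - γ) := by
    rw [← Real.rpow_add hn0]; ring_nf
  -- log(8CQ) ≤ c ≤ c n^γ
  have hlog : Real.log (8 * CQ) ≤ c * n ^ γ := by
    calc Real.log (8 * CQ) ≤ c := le_abs_self _
      _ = c * 1 := (mul_one c).symm
      _ ≤ c * n ^ γ := mul_le_mul_of_nonneg_left hnγ hc0
  -- (2L + c) n^γ = F A n^γ ≤ F n^γ n^(p-γ) = F n^p
  have hFA : 2 * L + c = F * A := by rw [hA]; field_simp
  calc 2 * (L * n ^ γ) + Real.log (8 * CQ) ≤ 2 * (L * n ^ γ) + c * n ^ γ := by linarith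
    _ = (2 * L + c) * n ^ γ := by ring
    _ = F * (A * n ^ γ) := by rw [hFA]; ring
    _ ≤ F * (n ^ (p - γ) * n ^ γ) := by
        apply mul_le_mul_of_nonneg_left _ hF.le
        exact mul_le_mul_of_nonneg_right hAn hγpos.le
    _ = F * n ^ p := by rw [hsplit]; ring

end Summit.AnomalousDissipation.AnomalousDissipation.Theorems
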